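import Literature.AlgebraicGeometry.HodgeTheory.WeilTypeClassReachOfPeriodSurjective
import Literature.AlgebraicGeometry.HodgeTheory.WeilFamilyPeriodConstructionAtWeilType
import Literature.AlgebraicGeometry.HodgeTheory.JacobianHodgeGenus
import Literature.AlgebraicGeometry.Motives.WeilTypeIIOperatorOfDiscriminant
import Literature.AlgebraicGeometry.Motives.WeilTypeIIComplexStructures
import HarnessLib

/-!
# A type-II fibre in every period-surjective Weil family of odd half-rank: quaternion multiplication from
# the period map and Riemann's theorem

Family `hodge`, layer `Literature/AlgebraicGeometry/HodgeTheory`; THEOREMS ONLY (no definition, no named fact,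
no `sorry`; D-0026). Companion of `HodgeTheory/WeilTypeClassReachOfPeriodSurjective` (Deligne's clause (b) for the
discriminant class from the period map [U] and Riemann's theorem [F]). There the INPUT to [U] was the period point
of another member; here it is a point of the TYPE-II SUB-DOMAIN (`Motives/WeilTypeIIComplexStructures`):

* ARITHMETIC (`Motives/WeilTypeIIOperatorOfDiscriminant`, Landherr transport of van Geemen's type-II model): the
  rational Weil datum `D_P = (H¹(P(ℂ); ℚ), ψ₀^*, E_ω)` of an abelian `2n`-fold `(P, ψ₀, h_K)` of Weil type `(n, n)`,
  `n` ODD, whose discriminant class is `[u]` with `u < 0`, carries a `ℚ`-linear `K`-ANTILINEAR ROSATI-SYMMETRIC `j`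
  with `j² = -u > 0` (`D = K ⊕ Kj = (-d, -u)_ℚ`, an indefinite quaternion algebra — Albert type II);
* PERIOD DOMAIN (`Motives/WeilTypeIIComplexStructures`): the type-II sub-domain `𝔖(j) ⊂ X⁺(D_P)` of complex structures of
  Weil type commuting with `j_ℝ` is NON-EMPTY (a Siegel space of genus `n`), and at `J ∈ 𝔖(j)` the operator `j` is an
  endomorphism of the `ℚ`-Hodge structure `D_P.hodgeStructure J`;
* PERIOD MAP [U] (the hypothesis, verbatim clause (5U) of Deligne's period construction
  `HodgeTheory.deligne1982_weilFamily_periodConstructionAtWeilType`, [Deligne1982HodgeCycles] proof of Thm. 4.8, Milne's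
  TeXed ed. p. 34: "the inverse image of `J ∈ X⁺` is `V(ℝ)` with the complex structure provided by `J`"): the fibre `Y_s`
  over `J` and a rational `K`-linear `β : H¹(P; ℚ) ≃ H¹(Y_s; ℚ)` carrying `V^{1,0}_J` into `H^{1,0}(Y_s)`;
* RIEMANN (`HodgeTheory/AbelianVarietyHodgeHomFullnessHolds.exists_hom_map_eq_nsmul_of_oneZero`, a THEOREM of the
  tree — fullness of `X ↦ H¹(X, ℚ)` on complex abelian varieties, [Lange2023AbelianVarietiesComplex] Prop. 1.1.6 (b),
  Thm. 2.1.13): the Hodge endomorphism `βjβ⁻¹` of `H¹(Y_s; ℚ)` is `k⁻¹ψ^*` for an ENDOMORPHISM `ψ` of `Y_s`;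
* FAITHFULNESS (`AbelianVariety.hom_eq_of_bettiCohomology_map_one_eq`): `Ψ_s ψ = -ψ Ψ_s` and `ψ² = c·𝟙`,
  `c = (k q)²(-u) > 0` (`q` the denominator clearing `-u`), read off `H¹`.

CONCLUSION (`exists_typeII_endomorphism_of_periodSurjective`): **every [U]-period-surjective family of abelian
`2n`-folds with `K`-action through an odd-`n` Weil-type member of discriminant class `[u]`, `u < 0`, has a FIBRE WITH
QUATERNION MULTIPLICATION `D_δ = K ⊕ Kψ = (-d, -u)_ℚ` BY ENDOMORPHISMS** — van Geemen 5.7 ("since the complex structure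
`J` commutes with the action of `K`, we have `K ⊂ End(X)_ℚ`") applied to `K ⊕ Kj`. For sixfolds (`n = 3`): every
discriminant class of the right sign has such fibres in its Weil family, granted [U] (the route memos' "(P₆) at members
carrying `ψ` as an ENDOMORPHISM, modulo J1"; vhodge ROUTE-P3-g17 §3 (b)(c)).

HONEST REMARKS. [U] is a HYPOTHESIS (for Deligne's family `Γ∖B → Γ∖X⁺` it is the definition of the fibre; the tree
constructs no moduli space); nothing here proves a case of the Hodge conjecture; the fibre found need not be simple or
"generic" (its period point is SOME point of `𝔖(j)`, possibly a CM point); positivity of the Rosati involution on `ψ` is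
not discussed (it holds: `ψ` is `h_K`-symmetric with `ψ² = c > 0`, but this is not derived here).

## References

* [Deligne1982HodgeCycles] P. Deligne (notes by J. S. Milne), LNM 900 (1982), §4, proof of Thm. 4.8 (Milne's TeXed ed.
  pp. 32–34: the family `B → X⁺`, "the inverse image of `J ∈ X⁺` is `V(ℝ)` with the complex structure provided by `J`").
* [vanGeemen1994HodgeAV] B. van Geemen, LNM 1594 (1994), Lemma 5.2, 5.3–5.8 (5.7: "`J` commutes with the action of `K`
  ⟹ `K ⊂ End(X)_ℚ`"), 5.11.
* [Shimura1963AnalyticFamilies] G. Shimura, Ann. of Math. 78 (1963), §4 (Type II).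
* [Lange2023AbelianVarietiesComplex] H. Lange, *Abelian Varieties over the Complex Numbers* (2023), Prop. 1.1.6,
  Lemma 1.1.11, Thm. 2.1.13 (Riemann: `Hom(X, X') = Hom` of polarizable Hodge structures).
* [Landherr1936HermitianForms] W. Landherr, Abh. Math. Sem. Hamburg 11 (1936).
* [vanGeemenVerra2003QuaternionicPryms] B. van Geemen, A. Verra, Topology 42 (2003), Lemma 4.5 (proof).
-/

noncomputable section

open CategoryTheory AlgebraicGeometry Polynomial Module
open scoped TensorProduct
open Literature.AlgebraicTopology.SingularHomology
open Literature.AlgebraicGeometry Literature.AlgebraicGeometry.Motives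
open Literature.AlgebraicGeometry.VanGeemen1994

namespace Literature.AlgebraicGeometry.HodgeTheory

section HOne

variable {A : AbelianVariety ℂ}

/-- `(f ≫ g)^*_ℚ x = f^*_ℚ (g^*_ℚ x)` on `H¹(A(ℂ); ℚ)` (functoriality of `bettiCohomology`).
[cite: Lange2023AbelianVarietiesComplex, Prop. 1.1.6] -/
theorem bettiMap_comp_apply (f g : A ⟶ A) (x : bettiCohomology A.X 1) :
    bettiCohomology.map (f ≫ g).hom.hom.hom 1 x =
      bettiCohomology.map f.hom.hom.hom 1 (bettiCohomology.map g.hom.hom.hom 1 x) := by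
  change bettiCohomology.map (f.hom.hom.hom ≫ g.hom.hom.hom) 1 x = _
  rw [bettiCohomology.map_comp]
  rfl

/-- `(-f)^*_ℚ = -f^*_ℚ` on `H¹(A(ℂ); ℚ)` (additivity of `f ↦ f^*|_{H¹}`, descended along the injective
`H¹(ℚ) → H¹(ℂ)`). [cite: Lange2023AbelianVarietiesComplex, Prop. 1.1.6] -/
theorem bettiMap_neg_apply (f : A ⟶ A) (x : bettiCohomology A.X 1) :
    bettiCohomology.map (-f).hom.hom.hom 1 x = -(bettiCohomology.map f.hom.hom.hom 1 x) := by
  apply ofRatClass_injective (Y := ComplexPoints A.X) 1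
  rw [ofRatClass_bettiMap, map_neg, ofRatClass_bettiMap, complexBetti_map_neg_one]
  rfl

/-- `[c]^*_ℚ x = c • x` on `H¹(A(ℂ); ℚ)` (`[c]^* = c` on `H¹`, Mumford §1 (3)). [cite: MumfordAV1970, §1 (3) and §19] -/
theorem bettiMap_nsmul_id_apply (c : ℕ) (x : bettiCohomology A.X 1) :
    bettiCohomology.map (c • 𝟙 A).hom.hom.hom 1 x = (c : ℚ) • x := by
  apply ofRatClass_injective (Y := ComplexPoints A.X) 1
  rw [ofRatClass_bettiMap, Motives.ofRatClass_smul, Rat.cast_natCast, complexBetti_map_nsmul_id_one_apply]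

end HOne

section TypeII

variable {n d : ℕ}

/-- **A TYPE-II FIBRE IN EVERY PERIOD-SURJECTIVE WEIL FAMILY OF ODD HALF-RANK.** Let `(P, ψ₀, h_K)`
(`h_K = d·e^*a + ψ₀^*e^*a`) be an abelian `2n`-fold, `n` ODD, carrying a non-zero Weil class of Hodge type `(n, n)`
(Weil type `(n, n)`) and a non-degenerate discriminant witness of class `[u]`, `u < 0`
(`HasWeilDiscriminantNondeg … (QuotientGroup.mk u)`), and let `(Y_s, Ψ_s)_{s ∈ S}` be ANY family of abelian `2n`-folds
with endomorphisms satisfying [U] (PERIOD SURJECTIVITY, verbatim as in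
`exists_isIsogeny_comm_of_periodSurjective_of_hasWeilDiscriminantNondeg` and clause (5U) of
`deligne1982_weilFamily_periodConstructionAtWeilType`: every `J ∈ X⁺(D_P)` is the period point of some `Y_s` through
a `K`-linear `β : H¹(P; ℚ) ≃ H¹(Y_s; ℚ)` carrying `V^{1,0}_J` into `H^{1,0}(Y_s)`). THEN some fibre carries
QUATERNION MULTIPLICATION extending `K`: there are `s`, an endomorphism `ψ` of `Y_s` and `c ≥ 1` with
`Ψ_s ≫ ψ = -(ψ ≫ Ψ_s)` and `ψ ≫ ψ = c • 𝟙`, where `c = r²·(-u)` for a non-zero rational `r` — so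
`ℚ⟨Ψ_s, ψ⟩ = (-d, -u)_ℚ = D_{[u]}`. Proof: Landherr-transport a Rosati-symmetric antilinear `j` with `j² = -u`
onto `D_P` (`Motives.exists_typeII_operator_of_weilDiscriminant_eq`), clear denominators (`j₁ = q·j`, `j₁² ∈ ℕ`),
pick `J` in the type-II sub-domain (`WeilDatum.exists_typeII_weilComplexStructure`: `J ∈ X⁺(D_P)` commuting with
`j₁`, `j₁` a Hodge endomorphism of the fibre over `J`), apply [U] to `J`, then Riemann's theorem
(`exists_hom_map_eq_nsmul_of_oneZero`) to `βj₁β⁻¹` (its complexification preserves `H^{1,0}(Y_s) = β_ℂ V^{1,0}_J`, the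
equality by `h^{1,0} = 2n` on both sides), and read `Ψ_sψ = -ψΨ_s`, `ψ² = k²j₁²` off `H¹(Y_s; ℚ)` (faithfulness).
[cite: Deligne1982HodgeCycles, proof of Thm. 4.8 — the family B → X⁺ and «the inverse image of J ∈ X⁺ is V(ℝ) with the complex structure provided by J» (Milne's TeXed ed. p. 34)]
[cite: vanGeemen1994HodgeAV, 5.5–5.8 and 5.7 («J commutes with the action of K ⟹ K ⊂ End(X)_ℚ»)]
[cite: Shimura1963AnalyticFamilies, §4 (Type II)] [cite: Lange2023AbelianVarietiesComplex, Prop. 1.1.6 and Thm. 2.1.13]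
[cite: Landherr1936HermitianForms] -/
theorem exists_typeII_endomorphism_of_periodSurjective (hodd : Odd n)
    {P : AbelianVariety ℂ} (hP : P.dim = 2 * n) {ψ₀ : P ⟶ P}
    (e : ProjectiveEmbedding P.X) {a : complexBetti (projectiveSpace e.n ℂ) 2}
    (ha : IsRationalClass a) (ha0 : a ≠ 0)
    (hweilP : ∃ c ∈ weilClassesOf P ψ₀ n d, c ≠ 0 ∧ IsOfHodgeType (2 * n) P.X (2 * n) n n c)
    (u : ℚˣ) (hu : (u : ℚ) < 0)
    (hδP : HasWeilDiscriminantNondeg P ψ₀ n d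
      ((d : ℂ) • complexBetti.map e.ι 2 a + complexBetti.map ψ₀.hom.hom.hom 2 (complexBetti.map e.ι 2 a))
      (QuotientGroup.mk u))
    {S : Type*} (Y : S → AbelianVariety ℂ) (Ψ : ∀ s, Y s ⟶ Y s) (hY : ∀ s, (Y s).dim = 2 * n)
    (hU : ∃ (m : ℕ) (hm : 1 ≤ m) (hPm : P.dim = m + 1) (hd : 0 < d) (hψ : ψ₀ ≫ ψ₀ = -(d • 𝟙 P))
        (ω : complexBetti P.X (2 + 2 * m)) (hω : IsRationalClass ω) (hω0 : ω ≠ 0),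
        ∀ (J : (weilDatumOfKsymm hm hPm hd hψ e ha ha0 hω hω0).Cx →ₗ[ℂ]
            (weilDatumOfKsymm hm hPm hd hψ e ha ha0 hω hω0).Cx)
          (hW : Motives.IsWeilComplexStructure (weilDatumOfKsymm hm hPm hd hψ e ha ha0 hω hω0).hForm J),
          ∃ (s : S) (β : bettiCohomology P.X 1 ≃ₗ[ℚ] bettiCohomology (Y s).X 1),
            (∀ x, β (bettiCohomology.map ψ₀.hom.hom.hom 1 x) =
              bettiCohomology.map (Ψ s).hom.hom.hom 1 (β x)) ∧
            ∀ x ∈ ((weilDatumOfKsymm hm hPm hd hψ e ha ha0 hω hω0).hodgeStructure J hW.sq).piece 1 0,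
              IsOfHodgeType (2 * n) (Y s).X 1 1 0
                (Motives.ofRatClassBaseChange (ComplexPoints (Y s).X) 1 (β.toLinearMap.baseChange ℂ x))) :
    ∃ (s : S) (ψ : Y s ⟶ Y s) (c : ℕ), 0 < c ∧ Ψ s ≫ ψ = -(ψ ≫ Ψ s) ∧ ψ ≫ ψ = c • 𝟙 (Y s) ∧
      ∃ r : ℚ, r ≠ 0 ∧ (c : ℚ) = r ^ 2 * (-(u : ℚ)) := by
  classical
  have hn : 1 ≤ n := hodd.pos
  obtain ⟨m, hm, hPm, hd, hψ, ω, hω, hω0, hsurj⟩ := hU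
  have hmn : m + 1 = 2 * n := by omega
  set DP := weilDatumOfKsymm hm hPm hd hψ e ha ha0 hω hω0 with hDP
  haveI : Module.Finite ℚ ↥(bettiCohomology P.X 1) := finite_bettiCohomology_one P
  have hVP : Module.finrank ℚ ↥(bettiCohomology P.X 1) = 4 * n := by
    rw [finrank_bettiCohomology_one, hP]; omega
  -- the field `K_d = ℚ(√-d)` acting through `√-d ↦ ψ₀^*`
  haveI : Fact (Irreducible (X ^ 2 + C (d : ℚ) : ℚ[X])) := ⟨irreducible_X_sq_add_C hd⟩
  have hdQ : (0 : ℚ) < d := by exact_mod_cast hd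
  have hα : weilSqrt d * weilSqrt d = algebraMap ℚ (weilField d) (-(d : ℚ)) :=
    weilSqrt_mul_self_eq_algebraMap d
  have hKspan : ∀ k : weilField d, ∃ p q : ℚ,
      k = algebraMap ℚ (weilField d) p + algebraMap ℚ (weilField d) q * weilSqrt d :=
    exists_eq_algebraMap_add_mul_weilSqrt d
  have hK2 : Module.finrank ℚ (weilField d) = 2 := Motives.finrank_rat_eq_two_of_sq_eq_neg hdQ hα hKspan
  obtain ⟨σ, hσα⟩ := exists_ringHom_weilSqrt_eq_neg d
  have hσ : ∀ k : weilField d, k * σ k = algebraMap ℚ (weilField d) (Algebra.norm ℚ k) :=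
    mul_conj_eq_algebraMap_norm hdQ hα hKspan σ hσα
  obtain ⟨instP, hinstP⟩ := exists_module_smul_eq hdQ hα hKspan DP.α DP.α_α
  letI : Module (weilField d) ↥(bettiCohomology P.X 1) := instP
  haveI : IsScalarTower ℚ (weilField d) ↥(bettiCohomology P.X 1) := hinstP.1
  have hαP : ∀ v, weilSqrt d • v = DP.α v := hinstP.2
  haveI : Module.Finite (weilField d) ↥(bettiCohomology P.X 1) :=
    Module.Finite.of_restrictScalars_finite ℚ (weilField d) _
  have hVK : Module.finrank (weilField d) ↥(bettiCohomology P.X 1) = 2 * n := by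
    have h := Module.finrank_mul_finrank ℚ (weilField d) ↥(bettiCohomology P.X 1)
    rw [hK2, hVP] at h
    omega
  have hWP : ∀ x y : ↥(bettiCohomology P.X 1),
      DP.E (weilSqrt d • x) (weilSqrt d • y) = (d : ℚ) * DP.E x y := fun x y => by
    rw [hαP, hαP]; exact DP.E_α x y
  -- the discriminant class of `D_P` is `[u]` (van Geemen 5.2 (3))
  obtain ⟨xP, ωP', amP, bmP, qP, hxP, hindP, hωP'r, hωP'0, hpairP, hdetP, hqP⟩ := hδP
  have hdiscP := quotientMk_eq_weilDiscriminant_weilDatumOfKsymm hn hmn hPm hd hψ e ha ha0 hω hω0 DP hDP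
    hαP xP ωP' amP bmP qP hxP hindP hωP'r hωP'0 hpairP hdetP
  have hdisc : weilDiscriminant DP.E (weilSqrt d) =
      (QuotientGroup.mk u : ℚˣ ⧸ normUnitsSubgroup ℚ (weilField d)) := by
    rw [← hdiscP]; exact hqP
  -- signature `(n, n)` (van Geemen 5.2 (4)), as `K`-subspaces
  obtain ⟨PP, NP, hPPα, hNPα, hPPn, hNPn, hPNP, hPPpos, hNPneg⟩ :=
    exists_signature_submodules_weilDatumOfKsymm hn hmn hPm hd hψ e ha ha0 hω hω0 hweilP
  rw [← hDP] at hPPα hNPα hPPpos hNPneg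
  obtain ⟨SP, hSP, hSPn⟩ := exists_submodule_of_smul_mem hKspan hK2 PP
    (fun x hx => by rw [hαP]; exact hPPα x hx) hPPn
  obtain ⟨SN, hSN, hSNn⟩ := exists_submodule_of_smul_mem hKspan hK2 NP
    (fun x hx => by rw [hαP]; exact hNPα x hx) hNPn
  have hinf : SP ⊓ SN = ⊥ := by
    rw [Submodule.eq_bot_iff]
    intro x hx
    have h : x ∈ PP ⊓ NP := ⟨(hSP x).1 hx.1, (hSN x).1 hx.2⟩
    rwa [hPNP, Submodule.mem_bot] at h
  -- the type-II operator `j`, `j² = -u` (Landherr transport of the model)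
  obtain ⟨j, hjα, hjj, hjE⟩ := exists_typeII_operator_of_weilDiscriminant_eq DP.E σ hdQ hα hσα hKspan hσ
    (fun x y => DP.E_swap y x) hWP hodd hVK
    ⟨SP, SN, hSPn, hSNn, hinf, fun x hx hx0 => by rw [hαP]; exact hPPpos x ((hSP x).1 hx) hx0,
      fun x hx hx0 => by rw [hαP]; exact hNPneg x ((hSN x).1 hx) hx0⟩ u hu hdisc
  have hjα' : ∀ x, j (DP.α x) = -(DP.α (j x)) := fun x => by rw [← hαP, ← hαP]; exact hjα x
  -- clearing denominators: `j₁ = q • j`, `q = den(-u)`, `j₁² = q² (-u) = q · num(-u) ∈ ℕ`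
  set b : ℚ := -(u : ℚ) with hb
  have hb0 : 0 < b := neg_pos.2 hu
  have hnum : 0 < b.num := Rat.num_pos.2 hb0
  obtain ⟨N, hNq, hNpos⟩ : ∃ N : ℕ, (N : ℚ) = (b.den : ℚ) * (b.den : ℚ) * b ∧ 0 < N := by
    refine ⟨b.den * b.num.toNat, ?_, Nat.mul_pos b.den_pos (by omega)⟩
    rw [Nat.cast_mul, mul_assoc, Rat.den_mul_eq_num]
    congr 1
    have : ((b.num.toNat : ℤ) : ℚ) = (b.num : ℚ) := by rw [Int.toNat_of_nonneg hnum.le]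
    exact_mod_cast this
  let j₁ : ↥(bettiCohomology P.X 1) →ₗ[ℚ] ↥(bettiCohomology P.X 1) := (b.den : ℚ) • j
  have hj₁ : ∀ x, j₁ x = (b.den : ℚ) • j x := fun _ => rfl
  have hj₁α : ∀ x, j₁ (DP.α x) = -(DP.α (j₁ x)) := fun x => by
    rw [hj₁, hj₁, hjα', map_smul, smul_neg]
  have hj₁j₁ : ∀ x, j₁ (j₁ x) = (N : ℚ) • x := fun x => by
    rw [hj₁, hj₁, map_smul, hjj, smul_smul, smul_smul, hNq]
  have hj₁E : ∀ x y, DP.E (j₁ x) y = DP.E x (j₁ y) := fun x y => by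
    rw [hj₁, hj₁, map_smul, LinearMap.smul_apply, map_smul, hjE]
  -- a point of the type-II sub-domain and the fibre over it ([U])
  obtain ⟨J, hW, hcomm, hpiece⟩ :=
    DP.exists_typeII_weilComplexStructure j₁ hj₁α hj₁j₁ hj₁E (by exact_mod_cast hNpos)
  obtain ⟨s, β, hβK, hβH⟩ := hsurj J hW
  -- the Hodge endomorphism `f = β j₁ β⁻¹` of `H¹(Y_s; ℚ)`
  let f : ↥(bettiCohomology (Y s).X 1) →ₗ[ℚ] ↥(bettiCohomology (Y s).X 1) :=
    β.toLinearMap ∘ₗ j₁ ∘ₗ β.symm.toLinearMap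
  have hf : ∀ x, f x = β (j₁ (β.symm x)) := fun _ => rfl
  haveI : Module.Finite ℚ ↥(bettiCohomology (Y s).X 1) := finite_bettiCohomology_one (Y s)
  haveI : Module.Finite ℂ (complexBetti (Y s).X 1) := finite_complexBetti_abelianVariety (Y s) 1
  have hXs : IsSmoothProjective (2 * n) (Y s).X := Motives.isSmoothProjective_of_dim_eq' (hY s)
  -- `β_ℂ V^{1,0}_J = H^{1,0}(Y_s)` by the dimension count `h^{1,0} = 2n`
  set ι := Motives.ofRatClassBaseChange (ComplexPoints (Y s).X) 1 with hι
  set M : Submodule ℂ (ℂ ⊗[ℚ] ↥(bettiCohomology (Y s).X 1)) :=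
    ((DP.hodgeStructure J hW.sq).piece 1 0).map (β.toLinearMap.baseChange ℂ) with hM
  set Nn : Submodule ℂ (ℂ ⊗[ℚ] ↥(bettiCohomology (Y s).X 1)) := (hodgeOneZero hXs).comap ι with hNn
  have hMN : M ≤ Nn := by
    rintro _ ⟨y, hy, rfl⟩
    exact hβH y hy
  have hβinj : Function.Injective (β.toLinearMap.baseChange ℂ) :=
    Function.LeftInverse.injective (HodgeStructure.symm_baseChange_baseChange (A := ℂ) β)
  have hfinM : Module.finrank ℂ M = 2 * n := by
    rw [hM, LinearEquiv.finrank_eq (Submodule.equivMapOfInjective _ hβinj _).symm,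
      WeilDatum.piece_one_zero_hodgeStructure]
    have h := HodgeStructure.two_mul_finrank_cxF1 (DP.realJ J) (DP.realJ_realJ J hW.sq)
    rw [hVP] at h
    omega
  have hfinN : Module.finrank ℂ Nn ≤ 2 * n := by
    have h1 : Module.finrank ℂ (Nn.map ι) ≤ Module.finrank ℂ (hodgeOneZero hXs) :=
      Submodule.finrank_mono (Submodule.map_comap_le ι _)
    rw [LinearEquiv.finrank_eq (Submodule.equivMapOfInjective _ (ofRatClassBaseChange_injective _ 1) _).symm,
      AbelianVariety.finrank_hodgeOneZero_eq_dim (Y s) hXs, hY s] at h1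
    exact h1
  have hMeq : M = Nn := Submodule.eq_of_le_of_finrank_le hMN (by rw [hfinM]; exact hfinN)
  have hHodge : ∀ x : ℂ ⊗[ℚ] ↥(bettiCohomology (Y s).X 1),
      IsOfHodgeType (Y s).dim (Y s).X 1 1 0 (Motives.ofRatClassBaseChange (ComplexPoints (Y s).X) 1 x) →
      IsOfHodgeType (Y s).dim (Y s).X 1 1 0
        (Motives.ofRatClassBaseChange (ComplexPoints (Y s).X) 1 (f.baseChange ℂ x)) := by
    intro x hx
    rw [hY s] at hx ⊢
    have hxN : x ∈ Nn := hx
    rw [← hMeq] at hxN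
    obtain ⟨y, hy, rfl⟩ := hxN
    have hfy : f.baseChange ℂ (β.toLinearMap.baseChange ℂ y) = β.toLinearMap.baseChange ℂ (j₁.baseChange ℂ y) := by
      change ((β.toLinearMap ∘ₗ j₁ ∘ₗ β.symm.toLinearMap).baseChange ℂ) (β.toLinearMap.baseChange ℂ y) = _
      rw [LinearMap.baseChange_comp, LinearMap.baseChange_comp, LinearMap.comp_apply, LinearMap.comp_apply,
        HodgeStructure.symm_baseChange_baseChange]
    rw [hfy]
    have hmem : β.toLinearMap.baseChange ℂ (j₁.baseChange ℂ y) ∈ Nn := by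
      rw [← hMeq]
      exact ⟨_, hpiece y hy, rfl⟩
    exact hmem
  -- Riemann: `u_Y^* = k · f` for an endomorphism `u_Y` of `Y_s`
  obtain ⟨uY, k, hk, huf⟩ := exists_hom_map_eq_nsmul_of_oneZero (Y s) (Y s) f hHodge
  refine ⟨s, uY, k ^ 2 * N, Nat.mul_pos (pow_pos hk 2) hNpos, ?_, ?_, ?_⟩
  · -- `Ψ_s ≫ u_Y = -(u_Y ≫ Ψ_s)` on `H¹(ℚ)`: `f` anticommutes with `Ψ_s^*` because `j₁` anticommutes with `ψ₀^*`
    have hβK' : ∀ y, β.symm (bettiCohomology.map (Ψ s).hom.hom.hom 1 y) =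
        bettiCohomology.map ψ₀.hom.hom.hom 1 (β.symm y) := fun y => by
      apply β.injective
      rw [LinearEquiv.apply_symm_apply, hβK, LinearEquiv.apply_symm_apply]
    have hj₁α' : ∀ x, j₁ (bettiCohomology.map ψ₀.hom.hom.hom 1 x) =
        -(bettiCohomology.map ψ₀.hom.hom.hom 1 (j₁ x)) := hj₁α
    have hfΨ : ∀ y, f (bettiCohomology.map (Ψ s).hom.hom.hom 1 y) =
        -(bettiCohomology.map (Ψ s).hom.hom.hom 1 (f y)) := fun y => by
      rw [hf, hf, hβK', hj₁α', map_neg, hβK]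
    apply AbelianVariety.hom_eq_of_bettiCohomology_map_one_eq
    ext y
    change bettiCohomology.map (Ψ s ≫ uY).hom.hom.hom 1 y = bettiCohomology.map (-(uY ≫ Ψ s)).hom.hom.hom 1 y
    rw [bettiMap_comp_apply, bettiMap_neg_apply, bettiMap_comp_apply, huf, huf, map_nsmul, hfΨ, smul_neg, neg_neg]
  · -- `u_Y ≫ u_Y = (k² N) • 𝟙` on `H¹(ℚ)`
    apply AbelianVariety.hom_eq_of_bettiCohomology_map_one_eq
    ext y
    change bettiCohomology.map (uY ≫ uY).hom.hom.hom 1 y = bettiCohomology.map ((k ^ 2 * N) • 𝟙 (Y s)).hom.hom.hom 1 y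
    rw [bettiMap_comp_apply, bettiMap_nsmul_id_apply, huf, huf, map_nsmul, hf, hf, LinearEquiv.symm_apply_apply,
      hj₁j₁, map_smul, LinearEquiv.apply_symm_apply, ← Nat.cast_smul_eq_nsmul ℚ, ← Nat.cast_smul_eq_nsmul ℚ,
      smul_smul, smul_smul]
    congr 1
    push_cast
    ring
  · -- `c = (k q)² (-u)`
    refine ⟨(k : ℚ) * b.den, mul_ne_zero (by exact_mod_cast hk.ne') (by exact_mod_cast b.den_pos.ne'), ?_⟩
    rw [Nat.cast_mul, Nat.cast_pow, hNq]
    ring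

/-- **A TYPE-II FIBRE IN DELIGNE'S WEIL FAMILY, MODULO J1.** Granted Deligne's period construction
(`deligne1982_weilFamily_periodConstructionAtWeilType`, the NAMED FACT «J1», a HYPOTHESIS here): for every abelian
`2n`-fold `(P, ψ₀, h_K)` OF WEIL TYPE `(n, n)` (`IsWeilType`), `n` ODD, `d ≥ 1`, whose `K`-symmetrised hyperplane class
`h_K = d·e^*a + ψ₀^*e^*a` has a non-degenerate discriminant witness of class `[u]`, `u < 0`, Deligne's smooth projective
family `f : 𝒳 → S` through `P = 𝒳_{s₀}` (global `√-d`-action `g`, abelian fibre charts `(Y_s, Ψ_s)`, one polarization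
class `a'`) has a FIBRE `Y_s` CARRYING AN ENDOMORPHISM `ψ` WITH `Ψ_s ψ = -ψ Ψ_s`, `ψ² = c·𝟙`, `c = r²(-u) > 0`: a member
with quaternion multiplication by `(-d, -u)_ℚ ⊇ K` (Albert type II on the non-split classes). For sixfolds (`n = 3`) this
is the route memos' "(P₆) ON FIBRES: a member of the cell's family carrying `ψ` as an ENDOMORPHISM, modulo J1" (vhodge
ROUTE-P3-g17 §3 (b)(c)). `exists_typeII_endomorphism_of_periodSurjective` fed with clause (5U) of the package.
[cite: Deligne1982HodgeCycles, §4 Prop. 4.4 and proof of Thm. 4.8 (Milne's TeXed ed. pp. 32–34: the family Γ∖B → Γ∖X⁺, «the inverse image of J ∈ X⁺ is V(ℝ) with the complex structure provided by J»)]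
[cite: vanGeemen1994HodgeAV, 4.9, 5.3–5.8 (5.7) and 5.11] [cite: Shimura1963AnalyticFamilies, §4 (Type II)]
[cite: Lange2023AbelianVarietiesComplex, Prop. 1.1.6 and Thm. 2.1.13] -/
theorem exists_typeII_fibre_of_periodConstructionAtWeilType
    (hJ : deligne1982_weilFamily_periodConstructionAtWeilType) (hodd : Odd n) (hd : 1 ≤ d)
    {P : AbelianVariety ℂ} {ψ₀ : P ⟶ P} (hWT : IsWeilType P ψ₀ n d)
    (e : ProjectiveEmbedding P.X) {a : complexBetti (projectiveSpace e.n ℂ) 2}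
    (ha : IsRationalClass a) (ha0 : a ≠ 0) (u : ℚˣ) (hu : (u : ℚ) < 0)
    (hδP : HasWeilDiscriminantNondeg P ψ₀ n d
      ((d : ℂ) • complexBetti.map e.ι 2 a + complexBetti.map ψ₀.hom.hom.hom 2 (complexBetti.map e.ι 2 a))
      (QuotientGroup.mk u)) :
    ∃ (𝒳 S : SchemeOver ℂ) (f : 𝒳 ⟶ S) (g : 𝒳 ⟶ 𝒳) (s₀ : ComplexPoints S)
      (e' : P.X ≅ fiberOver f s₀)
      (Y : ComplexPoints S → AbelianVariety ℂ) (Ψ : ∀ s, Y s ⟶ Y s)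
      (ε : ∀ s, (Y s).X ≅ fiberOver f s) (N : ℕ)
      (ι : 𝒳 ⟶ CategoryTheory.MonoidalCategoryStruct.tensorObj (projectiveSpace N ℂ) S)
      (a' : complexBetti (projectiveSpace N ℂ) 2),
      IsSmoothProjectiveFamily f (2 * n) ∧
      AlgebraicGeometry.IsClosedImmersion ι.left ∧
      ι ≫ CategoryTheory.CartesianMonoidalCategory.snd (projectiveSpace N ℂ) S = f ∧
      IrreducibleSpace S.left ∧ AlgebraicGeometry.Smooth S.hom ∧ IsQuasiProjectiveOver S ∧
      g ≫ f = f ∧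
      (e'.hom ≫ fiberι f s₀) ≫ g = ψ₀.hom.hom.hom ≫ (e'.hom ≫ fiberι f s₀) ∧
      (∀ s, (Y s).dim = 2 * n ∧ Ψ s ≫ Ψ s = -((d : ℤ) • 𝟙 (Y s)) ∧
        ((ε s).hom ≫ fiberι f s) ≫ g = (Ψ s).hom.hom.hom ≫ ((ε s).hom ≫ fiberι f s)) ∧
      IsRationalClass a' ∧
      complexBetti.map e'.hom 2 (complexBetti.map (fiberι f s₀) 2
        (complexBetti.map
          (ι ≫ CategoryTheory.CartesianMonoidalCategory.fst (projectiveSpace N ℂ) S) 2 a')) =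
        (d : ℂ) • complexBetti.map e.ι 2 a +
          complexBetti.map ψ₀.hom.hom.hom 2 (complexBetti.map e.ι 2 a) ∧
      ∃ (s : ComplexPoints S) (ψ : Y s ⟶ Y s) (c : ℕ), 0 < c ∧ Ψ s ≫ ψ = -(ψ ≫ Ψ s) ∧
        ψ ≫ ψ = c • 𝟙 (Y s) ∧ ∃ r : ℚ, r ≠ 0 ∧ (c : ℚ) = r ^ 2 * (-(u : ℚ)) := by
  have hn : 1 ≤ n := hodd.pos
  have hP : P.dim = 2 * n := hWT.dim_eq
  have hψZ : ψ₀ ≫ ψ₀ = -((d : ℤ) • 𝟙 P) := by rw [natCast_zsmul]; exact hWT.sq_eq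
  -- a non-zero Weil class of type `(n, n)` (the Weil plane is a plane; van Geemen 4.10 / 5.2 (5)–(6))
  have hweilP : ∃ c ∈ weilClassesOf P ψ₀ n d, c ≠ 0 ∧ IsOfHodgeType (2 * n) P.X (2 * n) n n c := by
    have h2 := hWT.finrank_weilClassesOf
    have hne : weilClassesOf P ψ₀ n d ≠ ⊥ := by
      intro h
      rw [h, finrank_bot] at h2
      exact two_ne_zero h2.symm
    obtain ⟨c, hc, hc0⟩ := (Submodule.ne_bot_iff _).1 hne
    exact ⟨c, hc, hc0, hWT.isOfHodgeType_of_mem_weilClassesOf hc⟩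
  obtain ⟨𝒳, S, f, g, s₀, e', Y, Ψ, ε, N, ι, a', hfam, hιcl, hιf, hirr, hsm, hqp, hgf, hge', hY, -, hU, ha'r,
    ha'pol⟩ := hJ n d hn hd P ψ₀ e a hP hψZ ha ha0 hWT
  obtain ⟨s, ψ, c, hc, hanti, hsq, hr⟩ := exists_typeII_endomorphism_of_periodSurjective hodd hP e ha ha0 hweilP
    u hu hδP Y Ψ (fun s => (hY s).1) hU
  exact ⟨𝒳, S, f, g, s₀, e', Y, Ψ, ε, N, ι, a', hfam, hιcl, hιf, hirr, hsm, hqp, hgf, hge', hY, ha'r, ha'pol,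
    s, ψ, c, hc, hanti, hsq, hr⟩

end TypeII

end Literature.AlgebraicGeometry.HodgeTheory

end
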